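import Summits.HodgeConjecture.HodgeConjecture.Theorems.R90S3PlantedPolynomial              -- ★ P3b: `exists_plantedPolynomial`, `map_eq_of_coeff_eq`, `intCast_eq_castHom_of_dvd`
import Summits.HodgeConjecture.HodgeConjecture.Theorems.R90S3IrreduciblePrescribedConstant   -- ★ P4′: ℓ-targets, two-prime sieve
import Summits.HodgeConjecture.HodgeConjecture.Theorems.R90S3DyadicTarget                   -- ★ B4b dyadic (this seat): `exists_dyadicTarget`
import Mathlib.Data.Nat.ChineseRemainder
import HarnessLib

/-!
# R90-TF · S3 · THEOREMS — `R90S3PlantingTargetList` ((U3-F) split, brick B4b-inst): the planted `g ∈ ℤ[X]` hitting the FOUR targets `{p^N, 2^M, ℓ₁, ℓ₂}` —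
# `g ≡ T_p (mod p^N)`, `g ≡ H₂ (mod 2^M)`, irreducible over `ℚ` (two-prime sieve at `ℓ₁, ℓ₂`), constant term `c₀` exact, all roots real and negative

R90-TF section S3 (successor dealer R90-C12-plan (g2), deal 2026-09-05T01:20:57Z «B4b-inst → K2E3-p21»; captain K2E3-p17 (g11)'s skeleton §B4–B5; census R90 bus
01:22:16Z); crux H413 (`stmt-HodgeConjecture-24833`, lane `--supports … --as helper`), route `HCCMUnconditional`.  Step B4∕B5 of the assembly P8 of the (U3-F) socket
`stub_R90_S3_auxGlobaliseField` (`Cruxes/H413/Lines/R90_S3_LocalTransportWaveG.lean` :645).  The `p`-adic target enters as an ABSTRACT monic `T_p ∈ (ℤ∕p^N)[X]` with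
`T_p(0) = c₀` (the captain instantiates `T_p := H.map (PadicInt.toZModPow N)` from ★ `R90S3LocalTarget`).  THEOREMS ONLY (no `def`, no `instance`, no notation, no named
fact, no `sorry`); ★∕Mathlib imports only; never imports `Cruxes/…/Lines`.

THE MATHEMATICS [Neukirch1999 Ch. I §3 (3.6); LidlNiederreiter1997 Ch. 3 §§1–2; Omeara1963 §63A].  §1 re-runs ★ B4a for FOUR EXPLICIT pairwise-coprime moduli
(non-dependent form; nested binary CRT `Nat.chineseRemainder`): a monic `g ∈ ℤ[X]` of degree `d` with `g(0) = c₀` and `g mod mⱼ = Tⱼ` (`j = 0..3`), real picture from ★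
P3b.  §2 instantiates: `m = (p^N, 2^M, ℓ₁, ℓ₂)` for distinct primes `p, 2, ℓ₁, ℓ₂`; `T₀ = T_p`; `T₁ = H₂ mod 2^M` with `H₂ = ∏ (X − rᵢ)` the dyadic target of ★
`exists_dyadicTarget` (`rᵢ ≡ 1 (mod 4)`, distinct, `H₂(0) = c₀`); `T₂ = (X + t)·h` with `h` irreducible of degree `d − 1` (★ P4′); `T₃` without roots (★ P4′: `d = 2` or
`d ≥ 4`; for `d = 3` an irreducible cubic, `gcd(3, ℓ₂ − 1) = 1`).  Then ★ P4′'s two-prime sieve makes `g` irreducible over `ℚ`.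
* §1 `exists_nat_modEq_four`, **`exists_planted_of_four_targets`**; §2 `exists_monic_no_root_coeff_zero_eq_zmod_of_two_le`, **`exists_planted_targetList`**;
  §3 (ED. 2, captain K2E3-p17 (g11)) **`exists_planted_targetList_forall`** — the dyadic roots `r` BEFORE the precisions `N, M` and the target `T_p`.

HONEST LABEL: HC_CM is proved only modulo the 7 printed citations (2 remaining named inputs: hLiu418 = stmt-HodgeConjecture-24832, h413 =
stmt-HodgeConjecture-24833) until rung 0 closes; glue toward the GENUINE residual (U3-F); proves nothing printed; count-neutral.

## References
* [Neukirch1999] J. Neukirch, *Algebraic Number Theory* (1999), Ch. I §3 (3.6).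
* [LidlNiederreiter1997] R. Lidl, H. Niederreiter, *Finite Fields*, 2nd ed. (1997), Ch. 3 §§1–2.
* [Omeara1963] O. T. O'Meara, *Introduction to Quadratic Forms* (1963), §63A.
-/

set_option autoImplicit false
-- the mandated namespace repeats the single-problem summit's segment (`HodgeConjecture.HodgeConjecture`)
set_option linter.dupNamespace false

noncomputable section

namespace Summit.HodgeConjecture.HodgeConjecture.R90.S3

open Polynomial

/-! ## §1 ★ B4a for four explicit moduli (non-dependent form) -/

/-- **CRT for four pairwise-coprime moduli** (nested Mathlib `Nat.chineseRemainder`). [cite: Neukirch1999, Ch. I §3 (3.6)] -/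
theorem exists_nat_modEq_four (m₀ m₁ m₂ m₃ : ℕ) (h01 : m₀.Coprime m₁) (h02 : m₀.Coprime m₂) (h03 : m₀.Coprime m₃) (h12 : m₁.Coprime m₂)
    (h13 : m₁.Coprime m₃) (h23 : m₂.Coprime m₃) (a₀ a₁ a₂ a₃ : ℕ) :
    ∃ n : ℕ, n ≡ a₀ [MOD m₀] ∧ n ≡ a₁ [MOD m₁] ∧ n ≡ a₂ [MOD m₂] ∧ n ≡ a₃ [MOD m₃] := by
  obtain ⟨k₁, hk₁0, hk₁1⟩ := Nat.chineseRemainder h01 a₀ a₁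
  have h012 : (m₀ * m₁).Coprime m₂ := Nat.Coprime.mul_left h02 h12
  obtain ⟨k₂, hk₂01, hk₂2⟩ := Nat.chineseRemainder h012 k₁ a₂
  have h0123 : (m₀ * m₁ * m₂).Coprime m₃ := Nat.Coprime.mul_left (Nat.Coprime.mul_left h03 h13) h23
  obtain ⟨k₃, hk₃012, hk₃3⟩ := Nat.chineseRemainder h0123 k₂ a₃
  refine ⟨k₃, ?_, ?_, ?_, hk₃3⟩
  · exact ((hk₃012.of_dvd (dvd_mul_of_dvd_left (dvd_mul_right m₀ m₁) m₂)).trans (hk₂01.of_dvd (dvd_mul_right m₀ m₁))).trans hk₁0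
  · exact ((hk₃012.of_dvd (dvd_mul_of_dvd_left (dvd_mul_left m₁ m₀) m₂)).trans (hk₂01.of_dvd (dvd_mul_left m₁ m₀))).trans hk₁1
  · exact (hk₃012.of_dvd (dvd_mul_left m₂ _)).trans hk₂2

/-- **★ B4a FOR FOUR TARGETS** (non-dependent form).  Monic targets `Tⱼ ∈ (ℤ∕mⱼ)[X]` of degree `d ≥ 2` modulo pairwise-coprime non-zero `m₀ … m₃`, all with constant
term `c₀ > 0`: a monic `g ∈ ℤ[X]` of degree `d` with `g(0) = c₀` EXACTLY, `g mod mⱼ = Tⱼ` for the four `j`, `d` distinct real roots, all negative, every complex root a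
negative real (★ P3b at `Q = m₀ m₁ m₂ m₃`). [cite: Neukirch1999, Ch. I §3 (3.6)] -/
theorem exists_planted_of_four_targets {d : ℕ} (hd : 2 ≤ d) (m₀ m₁ m₂ m₃ : ℕ) (hm₀ : m₀ ≠ 0) (hm₁ : m₁ ≠ 0) (hm₂ : m₂ ≠ 0) (hm₃ : m₃ ≠ 0)
    (h01 : m₀.Coprime m₁) (h02 : m₀.Coprime m₂) (h03 : m₀.Coprime m₃) (h12 : m₁.Coprime m₂) (h13 : m₁.Coprime m₃) (h23 : m₂.Coprime m₃)
    (T₀ : (ZMod m₀)[X]) (T₁ : (ZMod m₁)[X]) (T₂ : (ZMod m₂)[X]) (T₃ : (ZMod m₃)[X])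
    (hT₀ : T₀.Monic ∧ T₀.natDegree = d) (hT₁ : T₁.Monic ∧ T₁.natDegree = d) (hT₂ : T₂.Monic ∧ T₂.natDegree = d) (hT₃ : T₃.Monic ∧ T₃.natDegree = d)
    (c₀ : ℤ) (hc₀ : 0 < c₀) (h₀0 : T₀.coeff 0 = c₀) (h₁0 : T₁.coeff 0 = c₀) (h₂0 : T₂.coeff 0 = c₀) (h₃0 : T₃.coeff 0 = c₀) :
    ∃ g : ℤ[X], g.Monic ∧ g.natDegree = d ∧ g.coeff 0 = c₀ ∧
      g.map (Int.castRingHom (ZMod m₀)) = T₀ ∧ g.map (Int.castRingHom (ZMod m₁)) = T₁ ∧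
      g.map (Int.castRingHom (ZMod m₂)) = T₂ ∧ g.map (Int.castRingHom (ZMod m₃)) = T₃ ∧
      (g.map (Int.castRingHom ℝ)).roots.toFinset.card = d ∧ (∀ x ∈ (g.map (Int.castRingHom ℝ)).roots, x < 0) ∧
        ∀ z : ℂ, (g.map (Int.castRingHom ℂ)).IsRoot z → z.im = 0 ∧ z.re < 0 := by
  haveI : NeZero m₀ := ⟨hm₀⟩; haveI : NeZero m₁ := ⟨hm₁⟩; haveI : NeZero m₂ := ⟨hm₂⟩; haveI : NeZero m₃ := ⟨hm₃⟩
  set Q : ℕ := m₀ * m₁ * m₂ * m₃ with hQ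
  haveI : NeZero Q := ⟨by rw [hQ]; exact mul_ne_zero (mul_ne_zero (mul_ne_zero hm₀ hm₁) hm₂) hm₃⟩
  have hd₀ : m₀ ∣ Q := ⟨m₁ * m₂ * m₃, by rw [hQ]; ring⟩
  have hd₁ : m₁ ∣ Q := ⟨m₀ * m₂ * m₃, by rw [hQ]; ring⟩
  have hd₂ : m₂ ∣ Q := ⟨m₀ * m₁ * m₃, by rw [hQ]; ring⟩
  have hd₃ : m₃ ∣ Q := ⟨m₀ * m₁ * m₂, by rw [hQ]; ring⟩
  -- coefficientwise CRT residues
  choose n hn using fun k : ℕ =>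
    exists_nat_modEq_four m₀ m₁ m₂ m₃ h01 h02 h03 h12 h13 h23 (T₀.coeff k).val (T₁.coeff k).val (T₂.coeff k).val (T₃.coeff k).val
  obtain ⟨g, hgm, hgd, hg0, hmid, hcard, hneg, hcx⟩ := exists_plantedPolynomial hd Q (fun k => (n k : ZMod Q)) c₀ hc₀
  -- reading a residue class back modulo `mⱼ`
  have hread : ∀ {m : ℕ} [NeZero m] (hm : m ∣ Q) (T : (ZMod m)[X]) (k : ℕ), n k ≡ (T.coeff k).val [MOD m] → 0 < k → k < d →
      ((g.coeff k : ℤ) : ZMod m) = T.coeff k := fun hm T k hk hk0 hkd => by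
    rw [intCast_eq_castHom_of_dvd hm (hmid k hk0 hkd), map_natCast, (ZMod.natCast_eq_natCast_iff _ _ _).2 hk, ZMod.natCast_zmod_val]
  refine ⟨g, hgm, hgd, hg0, ?_, ?_, ?_, ?_, hcard, hneg, hcx⟩
  · exact map_eq_of_coeff_eq hgm hgd T₀ hT₀.1 hT₀.2 (by rw [hg0, h₀0]) fun k hk hkd => hread hd₀ T₀ k (hn k).1 hk hkd
  · exact map_eq_of_coeff_eq hgm hgd T₁ hT₁.1 hT₁.2 (by rw [hg0, h₁0]) fun k hk hkd => hread hd₁ T₁ k (hn k).2.1 hk hkd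
  · exact map_eq_of_coeff_eq hgm hgd T₂ hT₂.1 hT₂.2 (by rw [hg0, h₂0]) fun k hk hkd => hread hd₂ T₂ k (hn k).2.2.1 hk hkd
  · exact map_eq_of_coeff_eq hgm hgd T₃ hT₃.1 hT₃.2 (by rw [hg0, h₃0]) fun k hk hkd => hread hd₃ T₃ k (hn k).2.2.2 hk hkd

/-! ## §2 The instantiated list `{p^N, 2^M, ℓ₁, ℓ₂}` -/

/-- **The `ℓ₂`-target without roots for every `d ≥ 2`** (★ P4′: `d = 2` or `d ≥ 4` directly; `d = 3` an irreducible cubic, which needs `gcd(3, ℓ₂ − 1) = 1`).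
[cite: LidlNiederreiter1997, Ch. 3 §§1–2] -/
theorem exists_monic_no_root_coeff_zero_eq_zmod_of_two_le (ℓ : ℕ) [Fact ℓ.Prime] {d : ℕ} (hd : 2 ≤ d) (hd3 : d = 3 → Nat.Coprime 3 (ℓ - 1))
    {c : ZMod ℓ} (hc : c ≠ 0) : ∃ T : (ZMod ℓ)[X], T.Monic ∧ T.natDegree = d ∧ T.coeff 0 = c ∧ ∀ x : ZMod ℓ, ¬ T.IsRoot x := by
  by_cases h3 : d = 3
  · obtain ⟨T, hTm, hirr, hTd, hT0⟩ := exists_monic_irreducible_natDegree_eq_coeff_zero_eq_zmod ℓ (d := d) (by omega) (h3 ▸ hd3 h3) hc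
    refine ⟨T, hTm, hTd, hT0, fun x hx => ?_⟩
    have h1 : T.natDegree = 1 := natDegree_eq_of_degree_eq_some (degree_eq_one_of_irreducible_of_root hirr hx)
    omega
  · exact exists_monic_no_root_coeff_zero_eq (k := ZMod ℓ) (by omega) hc

/-- **B4b-inst — THE PLANTED POLYNOMIAL HITTING THE FOUR TARGETS `{p^N, 2^M, ℓ₁, ℓ₂}`.**  For distinct primes `p, 2, ℓ₁, ℓ₂`, exponents `N` and `M ≥ 1`, a degree `d ≥ 2`
(`gcd(3, ℓ₂ − 1) = 1` if `d = 3`), a constant `c₀ > 0` prime to `ℓ₂` with `(−1)^d c₀ ≡ 1 (mod 4)` and `c₀ ≠ (−1)^d b^k`, a monic `p`-adic target `T_p ∈ (ℤ∕p^N)[X]` of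
degree `d` with `T_p(0) = c₀`, and the dyadic base `b > 1`, `b ≡ 1 (mod 4)`: there are a monic `g ∈ ℤ[X]` of degree `d` and the dyadic roots `r : Fin d → ℤ₂` of ★
`exists_dyadicTarget` with `g(0) = c₀`, `g ≡ T_p (mod p^N)`, `g ≡ ∏ (X − rᵢ) (mod 2^M)` (`rᵢ` distinct, `≡ 1 (mod 4)`, `rᵢ = b^i` for `i < d − 1`), `g` IRREDUCIBLE over `ℚ`
(★ P4′ two-prime sieve at `ℓ₁, ℓ₂`), `d` distinct real roots, all negative, and every complex root a negative real.
[cite: Neukirch1999, Ch. I §3 (3.6)] [cite: LidlNiederreiter1997, Ch. 3 §§1–2] [cite: Omeara1963, §63A] -/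
theorem exists_planted_targetList {d : ℕ} (hd : 2 ≤ d) (p ℓ₁ ℓ₂ : ℕ) [hp : Fact p.Prime] [hℓ₁ : Fact ℓ₁.Prime] [hℓ₂ : Fact ℓ₂.Prime]
    (hp2 : p ≠ 2) (hℓ₁2 : ℓ₁ ≠ 2) (hℓ₂2 : ℓ₂ ≠ 2) (hℓ₁p : ℓ₁ ≠ p) (hℓ₂p : ℓ₂ ≠ p) (hℓ : ℓ₁ ≠ ℓ₂)
    (N M : ℕ) (hM : M ≠ 0) (c₀ : ℤ) (hc₀ : 0 < c₀) (hc₀ℓ₂ : ¬ (ℓ₂ : ℤ) ∣ c₀) (hd3 : d = 3 → Nat.Coprime 3 (ℓ₂ - 1))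
    (T_p : (ZMod (p ^ N))[X]) (hTm : T_p.Monic) (hTd : T_p.natDegree = d) (hT0 : T_p.coeff 0 = c₀)
    (b : ℤ) (hb1 : 1 < b) (hb4 : (4 : ℤ) ∣ b - 1) (hc4 : (4 : ℤ) ∣ (-1) ^ d * c₀ - 1) (hbc : ∀ k : ℕ, b ^ k ≠ (-1) ^ d * c₀) :
    ∃ (g : ℤ[X]) (r : Fin d → ℤ_[2]), g.Monic ∧ g.natDegree = d ∧ g.coeff 0 = c₀ ∧
      g.map (Int.castRingHom (ZMod (p ^ N))) = T_p ∧
      Function.Injective r ∧ (∀ i, (4 : ℤ_[2]) ∣ r i - 1) ∧ (∀ i : Fin d, (i : ℕ) + 1 < d → r i = (b : ℤ_[2]) ^ (i : ℕ)) ∧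
      g.map (Int.castRingHom (ZMod (2 ^ M))) = (∏ i, (X - C (r i))).map (PadicInt.toZModPow M) ∧
      Irreducible (g.map (Int.castRingHom ℚ)) ∧
      (g.map (Int.castRingHom ℝ)).roots.toFinset.card = d ∧ (∀ x ∈ (g.map (Int.castRingHom ℝ)).roots, x < 0) ∧
        ∀ z : ℂ, (g.map (Int.castRingHom ℂ)).IsRoot z → z.im = 0 ∧ z.re < 0 := by
  -- the moduli are pairwise coprime and non-zero
  have hp0 : p ≠ 0 := hp.out.ne_zero
  have hcp2 : p.Coprime 2 := (Nat.coprime_primes hp.out Nat.prime_two).2 hp2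
  have hcpℓ₁ : p.Coprime ℓ₁ := (Nat.coprime_primes hp.out hℓ₁.out).2 (Ne.symm hℓ₁p)
  have hcpℓ₂ : p.Coprime ℓ₂ := (Nat.coprime_primes hp.out hℓ₂.out).2 (Ne.symm hℓ₂p)
  have hc2ℓ₁ : (2 : ℕ).Coprime ℓ₁ := (Nat.coprime_primes Nat.prime_two hℓ₁.out).2 (Ne.symm hℓ₁2)
  have hc2ℓ₂ : (2 : ℕ).Coprime ℓ₂ := (Nat.coprime_primes Nat.prime_two hℓ₂.out).2 (Ne.symm hℓ₂2)
  have hcℓ : ℓ₁.Coprime ℓ₂ := (Nat.coprime_primes hℓ₁.out hℓ₂.out).2 hℓ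
  -- the dyadic target
  obtain ⟨r, hrinj, -, hr4, hrb, hHm, hHd, -, hHM⟩ := exists_dyadicTarget hd c₀ b hb1 hb4 hc4 hbc
  obtain ⟨hT₁m, hT₁d, hT₁0⟩ := hHM M hM
  -- the `ℓ₁`-target `(X + t) · h`, `h` irreducible of degree `d − 1`
  obtain ⟨t, h, -, hirr, -, -, hlm, hld, hl0⟩ := exists_linear_mul_irreducible_coeff_zero_eq (k := ZMod ℓ₁) hd ((c₀ : ℤ) : ZMod ℓ₁)
  -- the `ℓ₂`-target without roots
  have hcne : ((c₀ : ℤ) : ZMod ℓ₂) ≠ 0 := fun h0 => hc₀ℓ₂ ((ZMod.intCast_zmod_eq_zero_iff_dvd c₀ ℓ₂).1 h0)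
  obtain ⟨T₃, hT₃m, hT₃d, hT₃0, hT₃nr⟩ := exists_monic_no_root_coeff_zero_eq_zmod_of_two_le ℓ₂ hd hd3 hcne
  -- plant
  obtain ⟨g, hgm, hgd, hg0, hg₀, hg₁, hg₂, hg₃, hcard, hneg, hcx⟩ := exists_planted_of_four_targets hd (p ^ N) (2 ^ M) ℓ₁ ℓ₂
    (pow_ne_zero N hp0) (pow_ne_zero M two_ne_zero) hℓ₁.out.ne_zero hℓ₂.out.ne_zero
    (Nat.Coprime.pow N M hcp2) (Nat.Coprime.pow_left N hcpℓ₁) (Nat.Coprime.pow_left N hcpℓ₂) (Nat.Coprime.pow_left M hc2ℓ₁) (Nat.Coprime.pow_left M hc2ℓ₂) hcℓ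
    T_p ((∏ i, (X - C (r i))).map (PadicInt.toZModPow M)) ((X + C t) * h) T₃ ⟨hTm, hTd⟩ ⟨hT₁m, hT₁d⟩ ⟨hlm, hld⟩ ⟨hT₃m, hT₃d⟩
    c₀ hc₀ hT0 hT₁0 hl0 hT₃0
  -- irreducibility over `ℚ` by the two-prime sieve
  have hirrQ : Irreducible (g.map (Int.castRingHom ℚ)) :=
    irreducible_map_rat_of_map_eq_linear_mul_irreducible_of_forall_not_isRoot hgm hgd hd (X + C t) h (monic_X_add_C t) (natDegree_X_add_C t) hirr hg₂
      (fun x => by rw [hg₃]; exact hT₃nr x)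
  exact ⟨g, r, hgm, hgd, hg0, hg₀, hrinj, hr4, hrb, hg₁, hirrQ, hcard, hneg, hcx⟩

/-! ## §3 (ED. 2, captain K2E3-p17 (g11)) The dyadic roots FIRST, the precisions `N, M` AFTER — so the consumer can take `M ≥ M₀(r)` (★ B12 dyadic root reading) -/

/-- **THE PLANTED TARGET LIST, roots before precisions (ED. 2).**  As `exists_planted_targetList`, but the dyadic root vector `r : Fin d → ℤ_2` (distinct,
`≡ 1 (mod 4)`, `rᵢ = b^i` for `i + 1 < d`) is produced FIRST, and THEN for all precisions `N`, `M ≠ 0` and every `p`-adic target `T_p` (monic, degree `d`,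
`T_p(0) = c₀`) the planted `g`.  (Same proof: ★ `exists_dyadicTarget` does not depend on `M`.)
[cite: Neukirch1999, Ch. I §3 (3.6)] [cite: LidlNiederreiter1997, Ch. 3 §§1-2] -/
theorem exists_planted_targetList_forall {d : ℕ} (hd : 2 ≤ d) (p ℓ₁ ℓ₂ : ℕ) [hp : Fact p.Prime] [hℓ₁ : Fact ℓ₁.Prime] [hℓ₂ : Fact ℓ₂.Prime]
    (hp2 : p ≠ 2) (hℓ₁2 : ℓ₁ ≠ 2) (hℓ₂2 : ℓ₂ ≠ 2) (hℓ₁p : ℓ₁ ≠ p) (hℓ₂p : ℓ₂ ≠ p) (hℓ : ℓ₁ ≠ ℓ₂)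
    (c₀ : ℤ) (hc₀ : 0 < c₀) (hc₀ℓ₂ : ¬ (ℓ₂ : ℤ) ∣ c₀) (hd3 : d = 3 → Nat.Coprime 3 (ℓ₂ - 1))
    (b : ℤ) (hb1 : 1 < b) (hb4 : (4 : ℤ) ∣ b - 1) (hc4 : (4 : ℤ) ∣ (-1) ^ d * c₀ - 1) (hbc : ∀ k : ℕ, b ^ k ≠ (-1) ^ d * c₀) :
    ∃ r : Fin d → ℤ_[2], Function.Injective r ∧ (∀ i, (4 : ℤ_[2]) ∣ r i - 1) ∧ (∀ i : Fin d, (i : ℕ) + 1 < d → r i = (b : ℤ_[2]) ^ (i : ℕ)) ∧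
      ∀ N M : ℕ, M ≠ 0 → ∀ T_p : (ZMod (p ^ N))[X], T_p.Monic → T_p.natDegree = d → T_p.coeff 0 = c₀ →
      ∃ g : ℤ[X], g.Monic ∧ g.natDegree = d ∧ g.coeff 0 = c₀ ∧
        g.map (Int.castRingHom (ZMod (p ^ N))) = T_p ∧
        g.map (Int.castRingHom (ZMod (2 ^ M))) = (∏ i, (X - C (r i))).map (PadicInt.toZModPow M) ∧
        Irreducible (g.map (Int.castRingHom ℚ)) ∧
        (g.map (Int.castRingHom ℝ)).roots.toFinset.card = d ∧ (∀ x ∈ (g.map (Int.castRingHom ℝ)).roots, x < 0) ∧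
          ∀ z : ℂ, (g.map (Int.castRingHom ℂ)).IsRoot z → z.im = 0 ∧ z.re < 0 := by
  have hp0 : p ≠ 0 := hp.out.ne_zero
  have hcp2 : p.Coprime 2 := (Nat.coprime_primes hp.out Nat.prime_two).2 hp2
  have hcpℓ₁ : p.Coprime ℓ₁ := (Nat.coprime_primes hp.out hℓ₁.out).2 (Ne.symm hℓ₁p)
  have hcpℓ₂ : p.Coprime ℓ₂ := (Nat.coprime_primes hp.out hℓ₂.out).2 (Ne.symm hℓ₂p)
  have hc2ℓ₁ : (2 : ℕ).Coprime ℓ₁ := (Nat.coprime_primes Nat.prime_two hℓ₁.out).2 (Ne.symm hℓ₁2)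
  have hc2ℓ₂ : (2 : ℕ).Coprime ℓ₂ := (Nat.coprime_primes Nat.prime_two hℓ₂.out).2 (Ne.symm hℓ₂2)
  have hcℓ : ℓ₁.Coprime ℓ₂ := (Nat.coprime_primes hℓ₁.out hℓ₂.out).2 hℓ
  -- the dyadic target (independent of the precisions)
  obtain ⟨r, hrinj, -, hr4, hrb, hHm, hHd, -, hHM⟩ := exists_dyadicTarget hd c₀ b hb1 hb4 hc4 hbc
  refine ⟨r, hrinj, hr4, hrb, fun N M hM T_p hTm hTd hT0 => ?_⟩
  obtain ⟨hT₁m, hT₁d, hT₁0⟩ := hHM M hM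
  -- the `ℓ₁`-target `(X + t) · h`, `h` irreducible of degree `d − 1`
  obtain ⟨t, h, -, hirr, -, -, hlm, hld, hl0⟩ := exists_linear_mul_irreducible_coeff_zero_eq (k := ZMod ℓ₁) hd ((c₀ : ℤ) : ZMod ℓ₁)
  -- the `ℓ₂`-target without roots
  have hcne : ((c₀ : ℤ) : ZMod ℓ₂) ≠ 0 := fun h0 => hc₀ℓ₂ ((ZMod.intCast_zmod_eq_zero_iff_dvd c₀ ℓ₂).1 h0)
  obtain ⟨T₃, hT₃m, hT₃d, hT₃0, hT₃nr⟩ := exists_monic_no_root_coeff_zero_eq_zmod_of_two_le ℓ₂ hd hd3 hcne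
  -- plant
  obtain ⟨g, hgm, hgd, hg0, hg₀, hg₁, hg₂, hg₃, hcard, hneg, hcx⟩ := exists_planted_of_four_targets hd (p ^ N) (2 ^ M) ℓ₁ ℓ₂
    (pow_ne_zero N hp0) (pow_ne_zero M two_ne_zero) hℓ₁.out.ne_zero hℓ₂.out.ne_zero
    (Nat.Coprime.pow N M hcp2) (Nat.Coprime.pow_left N hcpℓ₁) (Nat.Coprime.pow_left N hcpℓ₂) (Nat.Coprime.pow_left M hc2ℓ₁) (Nat.Coprime.pow_left M hc2ℓ₂) hcℓ
    T_p ((∏ i, (X - C (r i))).map (PadicInt.toZModPow M)) ((X + C t) * h) T₃ ⟨hTm, hTd⟩ ⟨hT₁m, hT₁d⟩ ⟨hlm, hld⟩ ⟨hT₃m, hT₃d⟩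
    c₀ hc₀ hT0 hT₁0 hl0 hT₃0
  -- irreducibility over `ℚ` by the two-prime sieve
  have hirrQ : Irreducible (g.map (Int.castRingHom ℚ)) :=
    irreducible_map_rat_of_map_eq_linear_mul_irreducible_of_forall_not_isRoot hgm hgd hd (X + C t) h (monic_X_add_C t) (natDegree_X_add_C t) hirr hg₂
      (fun x => by rw [hg₃]; exact hT₃nr x)
  exact ⟨g, hgm, hgd, hg0, hg₀, hg₁, hirrQ, hcard, hneg, hcx⟩

end Summit.HodgeConjecture.HodgeConjecture.R90.S3

end
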